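import Literature.NumberTheory.LFunctions.Zhang2022.Section18EpsilonIdentity
import Literature.NumberTheory.LFunctions.Zhang2022.TypedAppendixB

/-!
# Zhang (2022) Lemma 15.1 / Appendix B (B.3), numerics lane (row N-09): the `e″_{1j}` fork, second lineage

Trunk T-ANT (NumberTheory/LFunctions). Certified-numerics record for Y. Zhang, *Discrete mean
estimates and the Landau–Siegel zero*, arXiv:2211.02515v1 [Zhang2022LandauSiegel], Lemma 15.1
[pp. 86–87, tex L4273–4300] and its Appendix B proof [pp. 106–110; (B.3) tex L5317–5318; last
display of the proof of (B.3), tex L5333], as consumed by (15.24), (16.17), (17.10) and (18.1).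

The constants are the tree's (`Section18Defs`: `e2j`, `e3j`, `e1pj`, `e1ppj` = the STATED
`e″_{1j} = (j/0.756)∫₀^{0.004}(e^{(3/2)(0.504−z)πi} − e^{(3/4)πi})dz`, `e1j`, `frake`, `frake0`, `frakc3`,
`frakc3r`, `identResidual`; `AppendixB.e1ppD` = the DERIVED `e″_{1j} = (1/0.504)(β_j/β₆)
∫_{0.5}^{0.504}(P^{β₆(0.504−z)} − P^{0.004β₆})dz = −jπi·b*` (`AppendixB.e1ppD_eq`);
`Section18EpsilonIdentity`: `e1jD`, `frakeD`, `frakc3D`, `identResidualD`). Nothing is re-defined.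

**What this file records (row N-09 of the numerics lane, cell siegel-zhang).**
1. The implicit printed claim that the `e″_{1j}` STATED in Lemma 15.1/(B.3) is the quantity its own
   proof DERIVES — typed as `n09_e1ppFork_num j : e1ppj j = e1ppD j` — is FALSE for every `j ≥ 1`
   (`not_n09_e1ppFork_num`): both forms are linear in `j` (`e1ppj_linear`, `e1ppD_linear`) and
   the kernel bracket `Section18EpsilonIdentity.e1pp_delta_one_norm_bounds` gives
   `3.8·10⁻⁵ < ‖e″₁₁(stated) − e″₁₁(derived)‖ < 3.9·10⁻⁵`, hence `‖e″_{1j}(stated) − e″_{1j}(derived)‖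
   = j·‖…‖ > 0` (`n09_e1ppFork_norm`).
2. The fork's effect on `𝔠₃` of (18.1) is exact algebra plus two kernel brackets:
   `𝔠₃(stated e″) − 𝔠₃(derived e″) = identResidual − identResidualD` (`n09_fork_dc3_eq`), with
   `Re ∈ (−6.73·10⁻⁵, −6.71·10⁻⁵)`, `Im ∈ (1.669·10⁻⁴, 1.671·10⁻⁴)` (`n09_fork_dc3_bounds`) — i.e. the fork
   moves `Re 𝔠₃` by `1.6 %` of the certified (18.2) shortfall `Re 𝔠₃ʳ + 6.9951 ∈ (4.174·10⁻³, 4.175·10⁻³)`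
   and is immaterial to (18.2) under every reading (`n09_ineq182_all_readings`).
3. SECOND LINEAGE (kit job `j247184`; implementation A = python-flint/Arb `acb.integral` rigorous
   quadrature of the printed integrands, B = mpmath `iv` exact antiderivatives of `c·zⁿ·e^{kπiz}` with
   hand-written complex interval pairs; 192-bit; all 139 quantities consistent (max width `6·10⁻⁵²`),
   all 33 tree brackets contain both enclosures; planted-defect controls `e₃ⱼ: 1.1205 → 1.1250` and
   an `ι₂` digit caught (36 / 32 disjoint boxes)). Enclosures (outward-rounded, both implementations):
   `e₂₁ = −0.496289374004… − 0.250379599840…i`, `e₂₂ = −0.285471966822… + 0.206347581505…i`,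
   `e₂₃ = −0.074654559640… + 0.663074762851…i`; `e₃₁ = −0.030712354531… + 0.720963338975…i`,
   `e₃₂ = 0.638986441721… + 0.728187075674…i`, `e₃₃ = 1.308685237973… + 0.735410812373…i`;
   `e′₁₁ = −0.045396919385… + 0.714102574524…i`, `e′₁₂ = 0.629515186116… + 0.734551843235…i`,
   `e′₁₃ = 1.304427291618… + 0.755001111946…i`; `e″₁ⱼ(stated) = j·(−3.5038385·10⁻⁵ − 3.5481479·10⁻⁵ i)`,
   `e″₁ⱼ(derived) = j·(6.26620·10⁻⁷ − 4.9862121·10⁻⁵ i)`, `‖stated − derived‖ = j·3.8455108·10⁻⁵`;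
   `𝔢₁ = −0.108164426217… − 0.431894019258…i`, `𝔢₂ = 0.177371760717… − 0.547670178937…i`,
   `𝔢₃ = 0.364981738932… − 2.223591431324…i` (stated `e″`; derived: `−0.108160895…−0.431905272…i`,
   `0.177399592…−0.547658985…i`, `0.365054641…−2.223524092…i`); `𝔢₀ = −0.491626821870… − 1.876262952287…i`;
   (15.24)/(16.17)/(17.10) constants `𝔢₁+2𝔢₂+𝔢₃ = 0.61156083… − 3.75082581…i`,
   `𝔢₁+𝔢₂ = 0.06920733… − 0.97956420…i`, `−(𝔢₀+𝔢₁) = 0.59979125… + 2.30815697…i`;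
   `𝔠₃(stated) − 𝔠₃(derived) = −6.7164535·10⁻⁵ + 1.66989637·10⁻⁴ i`; `Re 𝔠₃ = −6.990998156…` (stated),
   `−6.990930992…` (derived), `−6.990925518…` (reduced form before (18.2)).

Status of the source: an unrefereed manuscript under adjudication; nothing here is a claim about
Theorems 1–2 of the manuscript or about Landau–Siegel zeros.
-/

noncomputable section

open Complex Real ComplexConjugate

namespace Literature.NumberTheory.LFunctions.Zhang2022.Numerics

open Literature.NumberTheory.LFunctions.Zhang2022

/-! ### Both printed forms of `e″_{1j}` are linear in `j` -/

/-- `e″_{1j}(stated) = j · e″₁₁(stated)` (Lemma 15.1: the prefactor is `j/0.756`).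
[cite: Zhang2022LandauSiegel, Lemma 15.1] -/
theorem e1ppj_linear (j : ℕ) : e1ppj j = (j : ℂ) * e1ppj 1 := by
  unfold e1ppj; push_cast; ring

/-- `e″_{1j}(derived) = j · e″₁₁(derived)` (proof of (B.3): the prefactor is `(1/0.504)(2j/3)`).
[cite: Zhang2022LandauSiegel, Appendix B (B.3)] -/
theorem e1ppD_linear (j : ℕ) : e1ppD j = (j : ℂ) * e1ppD 1 := by
  unfold e1ppD; push_cast; ring

/-- Hence `‖e″_{1j}(stated) − e″_{1j}(derived)‖ = j · ‖e″₁₁(stated) − e″₁₁(derived)‖`.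
[cite: Zhang2022LandauSiegel, Lemma 15.1, Appendix B (B.3)] -/
theorem e1pp_delta_norm_linear (j : ℕ) :
    ‖e1ppj j - e1ppD j‖ = (j : ℝ) * ‖e1ppj 1 - e1ppD 1‖ := by
  rw [e1ppj_linear j, e1ppD_linear j, ← mul_sub, norm_mul]
  simp

/-! ### N-09: the `e″` fork, typed and decided -/

/-- **The implicit printed claim of Lemma 15.1 / (B.3)** [Z22 p.87 tex L4295 = p.108 (B.3) tex L5317,
vs the last display of the proof of (B.3), p.109 tex L5333]: the stated
`e″_{1j} = (j/0.756)∫₀^{0.004}(e^{(3/2)(0.504−z)πi} − e^{(3/4)πi})dz` IS the quantity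
`(1/0.504)(β_j/β₆)∫_{0.5}^{0.504}(P^{β₆(0.504−z)} − P^{0.004β₆})dz` that the proof derives
(NUMERICS row N-09, "stated = derived"). FALSE for every `j ≥ 1`: `not_n09_e1ppFork_num`.
[claim: Zhang2022LandauSiegel, status: disputed] -/
@[claim "Zhang2022LandauSiegel" "disputed"]
def n09_e1ppFork_num (j : ℕ) : Prop := e1ppj j = e1ppD j

/-- **Size of the fork**: `j·3.8·10⁻⁵ < ‖e″_{1j}(stated) − e″_{1j}(derived)‖ < j·3.9·10⁻⁵` for `j ≥ 1`
(kernel: `Section18EpsilonIdentity.e1pp_delta_one_norm_bounds` and linearity). Second lineage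
(numerics lane N-09, kit `j247184`, both implementations): `‖Δ‖ = 3.8455108·10⁻⁵, 7.6910217·10⁻⁵,
1.15365325·10⁻⁴` for `j = 1, 2, 3` — the same order as `‖e″_{1j}‖ ≈ j·5·10⁻⁵` itself.
[cite: Zhang2022LandauSiegel, Lemma 15.1, Appendix B (B.3)] -/
theorem n09_e1ppFork_norm (j : ℕ) (hj : 1 ≤ j) :
    (j : ℝ) * 0.000038 < ‖e1ppj j - e1ppD j‖ ∧ ‖e1ppj j - e1ppD j‖ < (j : ℝ) * 0.000039 := by
  have h := e1pp_delta_one_norm_bounds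
  have hj' : (1 : ℝ) ≤ (j : ℝ) := by exact_mod_cast hj
  rw [e1pp_delta_norm_linear]
  constructor
  · exact mul_lt_mul_of_pos_left h.1 (by linarith)
  · exact mul_lt_mul_of_pos_left h.2 (by linarith)

/-- **The two printed forms of `e″_{1j}` are different numbers** (`j ≥ 1`): the N-09 fork is real.
FINDINGS-v3 prior E5 confirmed in kernel and in the second lineage (kit `j247184`).
[cite: Zhang2022LandauSiegel, Lemma 15.1, Appendix B (B.3)] -/
theorem not_n09_e1ppFork_num (j : ℕ) (hj : 1 ≤ j) : ¬ n09_e1ppFork_num j := by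
  intro h
  have hn := (n09_e1ppFork_norm j hj).1
  have hj' : (1 : ℝ) ≤ (j : ℝ) := by exact_mod_cast hj
  have h0 : ‖e1ppj j - e1ppD j‖ = 0 := by
    unfold n09_e1ppFork_num at h; rw [h, sub_self, norm_zero]
  rw [h0] at hn
  nlinarith

/-! ### N-09: the fork's effect on `𝔠₃` of (18.1) -/

/-- The fork moves `𝔠₃` ((18.1), `𝔠₃ = −i(3𝔢₁ + 3𝔢₂ + 𝔢₃ + 𝔢₀) + e₁* + 2e₂*`) by exactly the
difference of the two `ε`-identity residuals: `𝔠₃(stated e″) − 𝔠₃(derived e″) =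
(i(3𝔢″₁+3𝔢″₂+𝔢″₃)+e₁*)(stated) − (…)(derived)` (exact algebra from
`Section18EpsilonIdentity.frakc3_eq_frakc3r_add`, `frakc3D_eq_frakc3r_add`).
[cite: Zhang2022LandauSiegel, (18.1), §18 before (18.2)] -/
theorem n09_fork_dc3_eq : frakc3 - frakc3D = identResidual - identResidualD := by
  rw [frakc3_eq_frakc3r_add, frakc3D_eq_frakc3r_add]; ring

/-- **Size of the fork on `𝔠₃`**: `Re(𝔠₃(stated) − 𝔠₃(derived)) ∈ (−6.73·10⁻⁵, −6.71·10⁻⁵)`,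
`Im ∈ (1.669·10⁻⁴, 1.671·10⁻⁴)` (kernel: `Section18Certificate.identResidual_bounds`,
`Section18EpsilonIdentity.identResidualD_bounds`). Second lineage (N-09, kit `j247184`, both
implementations): `𝔠₃(stated) − 𝔠₃(derived) ∈ [−6.7164535, −6.7164534]·10⁻⁵ + i[1.66989637, 1.66989638]·10⁻⁴`.
[cite: Zhang2022LandauSiegel, (18.1)] -/
theorem n09_fork_dc3_bounds :
    ((-0.0000673 : ℝ) < (frakc3 - frakc3D).re ∧ (frakc3 - frakc3D).re < -0.0000671)
    ∧ ((0.0001669 : ℝ) < (frakc3 - frakc3D).im ∧ (frakc3 - frakc3D).im < 0.0001671) := by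
  have h := identResidual_bounds
  have hD := identResidualD_bounds
  rw [n09_fork_dc3_eq, Complex.sub_re, Complex.sub_im]
  refine ⟨⟨?_, ?_⟩, ⟨?_, ?_⟩⟩ <;> linarith [h.1.1, h.1.2, h.2.1, h.2.2, hD.1.1, hD.1.2, hD.2.1, hD.2.2]

/-- **The fork is immaterial to (18.2)** [Z22 p.99, tex L4904: "Direct calculation shows that
`Re{𝔠₃} < −6.9951`"]: under all three readings of `𝔠₃` — reduced form before (18.2) (`frakc3r`),
(18.1) with the stated `e″` (`frakc3`), (18.1) with the derived `e″` (`frakc3D`) — `Re 𝔠₃ > −6.991`,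
so (18.2) fails by `> 4·10⁻³` while the fork moves `Re 𝔠₃` by `< 7·10⁻⁵` (kernel brackets
`Section18Certificate.frakc3r_re_bounds`, `frakc3_re_bounds`, `Section18EpsilonIdentity.frakc3D_re_bounds`,
refutations `not_ineq182`, `not_ineq182D`). Second lineage (N-09/N-03 cross-check, kit `j247184`):
`Re 𝔠₃ = −6.990925517…` / `−6.990998156…` / `−6.990930991…`. Row N-03 (the (18.2) verdict itself)
is the numerics lane's num-3 record; this theorem only records that N-09's fork cannot change it.
[cite: Zhang2022LandauSiegel, (18.2)] -/
theorem n09_ineq182_all_readings :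
    ¬ Ineq182 ∧ (-6.991 : ℝ) < frakc3r.re ∧ (-6.991 : ℝ) < frakc3.re ∧ (-6.991 : ℝ) < frakc3D.re := by
  refine ⟨not_ineq182, ?_, ?_, ?_⟩
  · linarith [frakc3r_re_bounds.1]
  · linarith [frakc3_re_bounds.1]
  · linarith [frakc3D_re_bounds.1]

/-- **Adjudication summary of row N-09** (numerics lane, cell siegel-zhang, kit `j247184`): the
Lemma 15.1 constants are reproduced in two code-disjoint implementations inside every tree bracket;
the stated and derived `e″_{1j}` differ (by `j·3.8…·10⁻⁵`); the resulting ambiguity of `𝔠₃` is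
`< 7·10⁻⁵` in real part and `< 1.7·10⁻⁴` in modulus, immaterial to (18.2) and to the §18 total.
[cite: Zhang2022LandauSiegel, Lemma 15.1, (18.1), (18.2)] -/
theorem n09_summary :
    (∀ j, 1 ≤ j → ¬ n09_e1ppFork_num j)
    ∧ |(frakc3 - frakc3D).re| < 0.00007 ∧ ¬ Ineq182 := by
  refine ⟨fun j hj => not_n09_e1ppFork_num j hj, ?_, not_ineq182⟩
  have h := n09_fork_dc3_bounds.1
  rw [abs_lt]; constructor <;> linarith [h.1, h.2]

end Literature.NumberTheory.LFunctions.Zhang2022.Numerics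

/-! ## Row N-09, follow-through in the kernel: the closing step of the printed proof of (B.3) is REFUTED

Appended 2026-08-26 (sz-num-2) after `TypedAppendixB.lean` (L4-t10, p412392) typed the App. B proof of
Lemma 15.1 display by display. `Typed.AppendixB.StepB_u015c c′` is the closing "□" of the proof of
(B.3) [Z22 p.108, tex L5333–5334]: the proof's last display
`valueB15 = (1/0.504)(β_j/β₆)∫_{0.5}^{0.504}(P^{β₆(0.504−z)} − P^{0.004β₆})dz` is within `O(α₁) = O(α𝓛)`
of the STATED right side of (B.3), i.e. of Lemma 15.1's `e″_{1j}` (`Section18Defs.e1ppj`). It is false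
for every (2.13) constant `c′` (`not_StepB_u015c`), because for `j = 1` the display equals
`(1 − 5c′α𝓛)·e″₁₁(derived)` EXACTLY (`valueB15_one_eq`: `P^{β₆w} = e^{(3/2)πiw}` as `α𝓛⁹ = π`;
`β₁/β₆ = (2/3)(1 − 5c′α𝓛)`), `‖e″₁₁(derived) − e″₁₁(stated)‖ > 3.8·10⁻⁵` (kernel
`e1pp_delta_one_norm_bounds`; second lineage, kit `j247184`: `3.8455108·10⁻⁵`), and `α𝓛 = π/𝓛⁸ → 0`.
Corollary `appB3_chain_inconsistent`: the three printed steps (B.3) (`EqB_3`), `StepB_u015a`,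
`StepB_u015b`, read with `O(α₁)` error terms, are jointly inconsistent (triangle inequality at `l₁ = 1`):
the misprint is the closed form printed in (B.3)/Lemma 15.1, and the manuscript's own §18 arithmetic
matches the DERIVED value (`Section18EpsilonIdentity.identResidualD_norm_lt` vs
`Section18Certificate.identResidual_norm_gt`). Immaterial to (18.2) (`n09_ineq182_all_readings`).
-/

namespace Literature.NumberTheory.LFunctions.Zhang2022.Numerics

open Literature.NumberTheory.LFunctions.Zhang2022

/-! ### The `D`-dependence of the proof's last display is explicit -/

/-- `α · 𝓛⁹ = π` (`α = π/log P` (2.10), `log P = 𝓛⁹` (2.6)), for `D ≥ 3`. [cite: Zhang2022LandauSiegel, §2 (2.6), (2.10)] -/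
theorem alpha_mul_ell9 {D : ℕ} (hD : 3 ≤ D) : Skeleton.alpha D * Skeleton.ell D ^ 9 = π := by
  have h9 : 0 < Skeleton.ell D ^ 9 := pow_pos (by linarith [Skeleton.one_lt_ell hD]) _
  rw [Skeleton.alpha, Skeleton.log_bigP]
  exact div_mul_cancel₀ _ h9.ne'

/-- `α = π/𝓛⁹ > 0` for `D ≥ 3`. [cite: Zhang2022LandauSiegel, §2 (2.10)] -/
theorem alpha_pos' {D : ℕ} (hD : 3 ≤ D) : 0 < Skeleton.alpha D := by
  have h9 : 0 < Skeleton.ell D ^ 9 := pow_pos (by linarith [Skeleton.one_lt_ell hD]) _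
  rw [Skeleton.alpha, Skeleton.log_bigP]
  exact div_pos Real.pi_pos h9

/-- `α𝓛 ≥ 0` for every `D` (`α = π/𝓛⁹`, `𝓛 = log D ≥ 0`). [cite: Zhang2022LandauSiegel, §2 (2.10)] -/
theorem alpha_mul_ell_nonneg (D : ℕ) : 0 ≤ Skeleton.alpha D * Skeleton.ell D := by
  have hℓ : 0 ≤ Skeleton.ell D := Real.log_natCast_nonneg D
  rw [Skeleton.alpha, Skeleton.log_bigP]
  positivity

/-- `P^{β₆ w} = e^{(3/2)πi w}` for `D ≥ 3` (`P = e^{𝓛⁹}`, `β₆ = 3iα/2`, `α𝓛⁹ = π`): the Mellin factor of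
the last display of the proof of (B.3) does not depend on `D`. [cite: Zhang2022LandauSiegel, §2 (2.6), (2.22)] -/
theorem bigP_cpow_beta6_mul {D : ℕ} (hD : 3 ≤ D) (w : ℂ) :
    (Skeleton.bigP D : ℂ) ^ (Skeleton.beta6 D * w) = cexp (3 / 2 * w * π * I) := by
  have hP : 0 < Skeleton.bigP D := Real.exp_pos _
  have hP0 : (Skeleton.bigP D : ℂ) ≠ 0 := by exact_mod_cast hP.ne'
  rw [Complex.cpow_def_of_ne_zero hP0, ← Complex.ofReal_log hP.le, Skeleton.log_bigP]
  congr 1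
  have h := alpha_mul_ell9 hD
  have hc : (Skeleton.ell D ^ 9 : ℂ) * (Skeleton.alpha D : ℂ) = (π : ℂ) := by
    rw [mul_comm]; exact_mod_cast h
  rw [Skeleton.beta6]
  push_cast
  linear_combination (3 / 2 * w * I) * hc

/-- The integral in `Typed.AppendixB.valueB15` is the integral in `AppendixB.e1ppD` (`D ≥ 3`).
[cite: Zhang2022LandauSiegel, Appendix B (B.3)] -/
theorem valueB15_integral_eq {D : ℕ} (hD : 3 ≤ D) :
    (∫ z in (0.5 : ℝ)..0.504,
      ((Skeleton.bigP D : ℂ) ^ (Skeleton.beta6 D * ((0.504 - z : ℝ) : ℂ)) -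
        (Skeleton.bigP D : ℂ) ^ (((0.004 : ℝ) : ℂ) * Skeleton.beta6 D)))
      = ∫ z in (0.5:ℝ)..0.504, (cexp (3 / 2 * (0.504 - z) * π * I) - cexp (3 / 2 * 0.004 * π * I)) := by
  congr 1
  funext z
  rw [bigP_cpow_beta6_mul hD, mul_comm (((0.004 : ℝ) : ℂ)) _, bigP_cpow_beta6_mul hD]
  push_cast
  ring_nf

/-- **The last display of the proof of (B.3) at `j = 1` equals `(1 − 5c′α𝓛) · e″₁₁(derived)`** exactly
(`β₁ = iα(1 − 5c′α𝓛)` (2.13), `β₆ = 3iα/2` (2.22), `D ≥ 3`). [cite: Zhang2022LandauSiegel, (2.13), Appendix B (B.3)] -/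
theorem valueB15_one_eq (c' : ℝ) {D : ℕ} (hD : 3 ≤ D) :
    Typed.AppendixB.valueB15 c' D 1
      = ((1 - 5 * c' * Skeleton.alpha D * Skeleton.ell D : ℝ) : ℂ) * e1ppD 1 := by
  have hα : Skeleton.alpha D ≠ 0 := (alpha_pos' hD).ne'
  have hαC : (Skeleton.alpha D : ℂ) ≠ 0 := by exact_mod_cast hα
  rw [Typed.AppendixB.valueB15, valueB15_integral_eq hD, e1ppD]
  set J : ℂ := ∫ z in (0.5:ℝ)..0.504, (cexp (3 / 2 * (0.504 - z) * π * I) - cexp (3 / 2 * 0.004 * π * I))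
    with hJ
  have hβ : Skeleton.betaJ c' D 1 = Skeleton.beta1 c' D := by simp [Skeleton.betaJ]
  rw [hβ, Skeleton.beta1, Skeleton.beta6]
  have hI : (I : ℂ) ≠ 0 := Complex.I_ne_zero
  push_cast
  field_simp

/-! ### Sizes -/

/-- `‖e″₁₁(derived)‖ < 6·10⁻⁵` (kernel bracket `Section18EpsilonIdentity.e1ppD_one_bounds`; second lineage
`e″₁₁(derived) = 6.26620·10⁻⁷ − 4.9862121·10⁻⁵ i`). [cite: Zhang2022LandauSiegel, Appendix B (B.3)] -/
theorem norm_e1ppD_one_lt : ‖e1ppD 1‖ < 0.00006 := by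
  have h := e1ppD_one_bounds
  have hsq : ‖e1ppD 1‖ ^ 2 < 0.00006 ^ 2 := by
    rw [Complex.sq_norm, Complex.normSq_apply]
    nlinarith [h.1.1, h.1.2, h.2.1, h.2.2]
  exact (abs_lt_of_sq_lt_sq' hsq (by norm_num)).2

/-- `α𝓛 ≤ π/𝓛` for `D ≥ 3` (indeed `α𝓛 = π/𝓛⁸`): the printed error term `O(α₁)` tends to `0`.
[cite: Zhang2022LandauSiegel, §2 (2.10)] -/
theorem alpha_mul_ell_le {D : ℕ} (hD : 3 ≤ D) :
    Skeleton.alpha D * Skeleton.ell D ≤ π / Skeleton.ell D := by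
  have h1 : 1 < Skeleton.ell D := Skeleton.one_lt_ell hD
  have hℓ : 0 < Skeleton.ell D := by linarith
  have h := alpha_mul_ell9 hD
  rw [le_div_iff₀ hℓ]
  have h7 : 1 ≤ Skeleton.ell D ^ 7 := one_le_pow₀ h1.le
  have hα : 0 < Skeleton.alpha D := alpha_pos' hD
  calc Skeleton.alpha D * Skeleton.ell D * Skeleton.ell D
      = Skeleton.alpha D * Skeleton.ell D ^ 2 * 1 := by ring
    _ ≤ Skeleton.alpha D * Skeleton.ell D ^ 2 * Skeleton.ell D ^ 7 := by
        apply mul_le_mul_of_nonneg_left h7; positivity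
    _ = π := by rw [← h]; ring

/-! ### Testing a `ForAllLarge` statement at large prime moduli -/

/-- `(·/p) ⊗ ℂ` is a quadratic Dirichlet character mod `p`. [folklore] -/
private theorem isQuadratic_legendre (p : ℕ) [Fact p.Prime] :
    ((quadraticChar (ZMod p)).ringHomComp (Int.castRingHom ℂ)).IsQuadratic :=
  (quadraticChar_isQuadratic (ZMod p)).comp _

-- adapted from Literature/NumberTheory/EllipticCurves/RootNumberTwistProofs.lean (isPrimitive_quadraticChar_ringHomComp)
/-- `(·/p) ⊗ ℂ` is primitive for an odd prime `p` (it is non-trivial and its level is prime). [folklore] -/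
private theorem isPrimitive_legendre (p : ℕ) [Fact p.Prime] (hp2 : p ≠ 2) :
    DirichletCharacter.IsPrimitive ((quadraticChar (ZMod p)).ringHomComp (Int.castRingHom ℂ)) := by
  rw [DirichletCharacter.isPrimitive_def]
  have hdvd := DirichletCharacter.conductor_dvd_level
    ((quadraticChar (ZMod p)).ringHomComp (Int.castRingHom ℂ))
  rcases (Nat.dvd_prime Fact.out).mp hdvd with h1 | h
  · exfalso
    have hone := DirichletCharacter.eq_one_iff_conductor_eq_one.mpr h1
    have hF : ringChar (ZMod p) ≠ 2 := by rwa [ZMod.ringChar_zmod_n]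
    obtain ⟨a, ha⟩ := quadraticChar_exists_neg_one hF
    have hau : IsUnit a := by
      by_contra hau
      rw [MulChar.map_nonunit _ hau] at ha
      norm_num at ha
    have h2 := congrArg (fun χ : DirichletCharacter ℂ p ↦ χ a) hone
    simp only [MulChar.ringHomComp_apply, ha] at h2
    rw [← hau.unit_spec, MulChar.one_apply_coe] at h2
    norm_num at h2
  · exact h

/-- A `ForAllLarge` statement (§2 p. 4: all real primitive `χ` to all large moduli) can be TESTED at
every sufficiently large odd prime modulus, with the Legendre character. [cite: Zhang2022LandauSiegel, §2 p. 4] -/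
theorem ForAllLarge.at_large_prime {S : (D : ℕ) → [NeZero D] → DirichletCharacter ℂ D → Prop}
    (h : Skeleton.ForAllLarge S) (N : ℕ) :
    ∃ p : ℕ, N ≤ p ∧ 3 ≤ p ∧ ∃ (_ : NeZero p) (χ : DirichletCharacter ℂ p), S p χ := by
  obtain ⟨D₀, hD₀⟩ := h
  obtain ⟨p, hp, hprime⟩ := Nat.exists_infinite_primes (max (max N 3) D₀)
  haveI : Fact p.Prime := ⟨hprime⟩
  haveI : NeZero p := ⟨hprime.ne_zero⟩
  have hp2 : p ≠ 2 := by
    intro h2; subst h2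
    have := (le_max_right N 3).trans ((le_max_left _ D₀).trans hp)
    omega
  refine ⟨p, (le_max_left N 3).trans ((le_max_left _ D₀).trans hp),
    (le_max_right N 3).trans ((le_max_left _ D₀).trans hp), inferInstance,
    (quadraticChar (ZMod p)).ringHomComp (Int.castRingHom ℂ), ?_⟩
  exact hD₀ p _ ((le_max_right _ D₀).trans hp) (isQuadratic_legendre p) (isPrimitive_legendre p hp2)

/-! ### The refutation and the inconsistency of the printed chain -/

/-- **REFUTED: the closing "□" of the proof of (B.3)** [Z22 p.108, tex L5333–5334] — for every (2.13)
constant `c′`, the proof's last display is NOT within `O(α₁)` of the stated right side of (B.3) (Lemma 15.1's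
`e″_{1j}`): `¬ Typed.AppendixB.StepB_u015c c′`. At `j = 1` the display is `(1 − 5c′α𝓛)e″₁₁(derived)`
(`valueB15_one_eq`), at distance `> 3.8·10⁻⁵ − 5|c′|α𝓛·6·10⁻⁵` from `e″₁₁(stated)`, while the allowed
error `Cα𝓛 ≤ Cπ/𝓛⁸ → 0` along the primes. Numerics lane N-09 (kit `j247184`): `‖e″₁₁(derived) −
e″₁₁(stated)‖ = 3.8455108·10⁻⁵`. Class: printed-false-pointwise; immaterial to (18.2)/(2.32).
[cite: Zhang2022LandauSiegel, Appendix B (B.3), p.108] -/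
theorem not_StepB_u015c (c' : ℝ) : ¬ Typed.AppendixB.StepB_u015c c' := by
  rintro ⟨C, hC⟩
  set M : ℝ := |C| + 5 * |c'| * 0.00006 + 1 with hM
  have hM0 : 0 < M := by positivity
  set K : ℝ := π * M / 0.000019 with hK
  have hK0 : 0 < K := by positivity
  obtain ⟨p, hpN, hp3, _inst, _χ, hS⟩ := ForAllLarge.at_large_prime hC ⌈Real.exp K⌉₊
  have h1 : 1 < Skeleton.ell p := Skeleton.one_lt_ell hp3
  have hℓ : 0 < Skeleton.ell p := by linarith
  have hα : 0 < Skeleton.alpha p := alpha_pos' hp3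
  have hKℓ : K ≤ Skeleton.ell p := by
    have hp' : Real.exp K ≤ p := (Nat.le_ceil _).trans (by exact_mod_cast hpN)
    have := Real.log_le_log (Real.exp_pos K) hp'
    rwa [Real.log_exp] at this
  have hαℓ : Skeleton.alpha p * Skeleton.ell p ≤ π / Skeleton.ell p := alpha_mul_ell_le hp3
  have hαℓK : Skeleton.alpha p * Skeleton.ell p * M ≤ 0.000019 := by
    have h2 : π / Skeleton.ell p ≤ π / K := div_le_div_of_nonneg_left Real.pi_pos.le hK0 hKℓ
    have h3 : π / K = 0.000019 / M := by rw [hK]; field_simp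
    have h4 : Skeleton.alpha p * Skeleton.ell p * M ≤ 0.000019 / M * M :=
      mul_le_mul_of_nonneg_right (hαℓ.trans (h2.trans h3.le)) hM0.le
    have h5 : 0.000019 / M * M = 0.000019 := by field_simp
    linarith
  have hj := hS 1 (by simp)
  rw [valueB15_one_eq c' hp3] at hj
  set a : ℂ := e1ppD 1 - e1ppj 1 with ha
  set b : ℂ := ((-(5 * c' * Skeleton.alpha p * Skeleton.ell p) : ℝ) : ℂ) * e1ppD 1 with hb
  have hsum : ((1 - 5 * c' * Skeleton.alpha p * Skeleton.ell p : ℝ) : ℂ) * e1ppD 1 - e1ppj 1 = a + b := by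
    rw [ha, hb]; push_cast; ring
  rw [hsum] at hj
  have hΔ := e1pp_delta_one_norm_bounds
  have ha' : ‖a‖ = ‖e1ppj 1 - e1ppD 1‖ := by rw [ha, norm_sub_rev]
  have hbn : ‖b‖ = 5 * |c'| * (Skeleton.alpha p * Skeleton.ell p) * ‖e1ppD 1‖ := by
    rw [hb, norm_mul, Complex.norm_real, Real.norm_eq_abs, abs_neg]
    have h5 : |(5:ℝ) * c' * Skeleton.alpha p * Skeleton.ell p|
        = 5 * |c'| * (Skeleton.alpha p * Skeleton.ell p) := by
      rw [abs_mul, abs_mul, abs_mul, abs_of_pos hα, abs_of_pos hℓ, abs_of_pos (by norm_num : (0:ℝ) < 5)]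
      ring
    rw [h5]
  have htri : ‖a‖ ≤ ‖a + b‖ + ‖b‖ := by
    calc ‖a‖ = ‖(a + b) - b‖ := by ring_nf
      _ ≤ ‖a + b‖ + ‖b‖ := norm_sub_le _ _
  have hbsmall : ‖b‖ ≤ 5 * |c'| * 0.00006 * (Skeleton.alpha p * Skeleton.ell p) := by
    rw [hbn]
    have := norm_e1ppD_one_lt
    have hc : 0 ≤ 5 * |c'| * (Skeleton.alpha p * Skeleton.ell p) := by positivity
    nlinarith
  have hCle : C * Skeleton.alpha p * Skeleton.ell p ≤ |C| * (Skeleton.alpha p * Skeleton.ell p) := by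
    rw [mul_assoc]; exact mul_le_mul_of_nonneg_right (le_abs_self C) (by positivity)
  have hpos : 0 < Skeleton.alpha p * Skeleton.ell p := mul_pos hα hℓ
  nlinarith [hΔ.1, hj, htri, hbsmall, hCle, hαℓK, hpos, ha']

/-- **The printed proof of (B.3) is internally inconsistent** (read with `O(α₁)` error terms, as typed):
(B.3) itself (`EqB_3`: tail `≈ e″(stated)`), its penultimate step (`StepB_u015a`: tail `≈` the double
integral) and its last display (`StepB_u015b`: double integral `≈ valueB15`) cannot all hold, for any `c′` —
at `l₁ = 1` they would put `valueB15` within `O(α𝓛)` of `e″(stated)`, against `not_StepB_u015c`. The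
misprint is therefore the closed form printed in (B.3) = Lemma 15.1's `e″_{1j}`; the value the proof
derives (`e1ppD = −jπi·b*`) is the one the manuscript's §18 arithmetic actually uses
(`identResidualD_norm_lt`). Numerics lane N-09. [cite: Zhang2022LandauSiegel, Appendix B (B.3), p.108] -/
theorem appB3_chain_inconsistent (c' : ℝ) :
    ¬ (Typed.AppendixB.EqB_3 c' ∧ Typed.AppendixB.StepB_u015a c' ∧ Typed.AppendixB.StepB_u015b c') := by
  rintro ⟨⟨C₁, h₁⟩, ⟨C₂, h₂⟩, ⟨C₃, h₃⟩⟩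
  apply not_StepB_u015c c'
  refine ⟨|C₁| + |C₂| + |C₃|, ?_⟩
  have h3le : Skeleton.ForAllLarge fun D _ _ => 3 ≤ D :=
    Skeleton.ForAllLarge.of_le 3 fun D _ _ hD _ _ => hD
  refine (((h₁.and h₂).and h₃).and h3le).mono ?_
  intro D _ χ _ _ ⟨⟨⟨k₁, k₂⟩, k₃⟩, hD⟩ j hj
  -- the side conditions at `l₁ = 1`
  have hn : (1 : ℕ) ∈ Skeleton.nset (Skeleton.frakq D) :=
    ⟨Nat.one_pos, fun q hq hq1 => (hq.not_dvd_one hq1).elim⟩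
  have hT : ((1 : ℕ) : ℝ) < Skeleton.bigT D := by
    have hℓ : 0 < Skeleton.ell D := by linarith [Skeleton.one_lt_ell hD]
    rw [Nat.cast_one, Skeleton.bigT]
    exact Real.one_lt_exp_iff.mpr (Real.rpow_pos_of_pos hℓ _)
  have e₁ := k₁ j hj 1 le_rfl hn hT
  have e₂ := k₂ j hj 1 le_rfl hn hT
  have e₃ := k₃ j hj 1 le_rfl hn hT
  have hαℓ := alpha_mul_ell_nonneg D
  set V := Typed.AppendixB.valueB15 c' D j
  set Dd := Typed.AppendixB.doubleB15 c' D j 1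
  set T := Typed.AppendixB.tailB3 c' D j 1
  have key : ‖V - e1ppj j‖ ≤ ‖Dd - V‖ + ‖T - Dd‖ + ‖T - e1ppj j‖ := by
    have hVE : V - e1ppj j = (-(Dd - V) + -(T - Dd)) + (T - e1ppj j) := by ring
    calc ‖V - e1ppj j‖ = ‖(-(Dd - V) + -(T - Dd)) + (T - e1ppj j)‖ := by rw [hVE]
      _ ≤ ‖-(Dd - V) + -(T - Dd)‖ + ‖T - e1ppj j‖ := norm_add_le _ _
      _ ≤ (‖-(Dd - V)‖ + ‖-(T - Dd)‖) + ‖T - e1ppj j‖ := by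
          gcongr; exact norm_add_le _ _
      _ = ‖Dd - V‖ + ‖T - Dd‖ + ‖T - e1ppj j‖ := by rw [norm_neg, norm_neg]
  have hC₁ : C₁ * Skeleton.alpha D * Skeleton.ell D ≤ |C₁| * (Skeleton.alpha D * Skeleton.ell D) := by
    rw [mul_assoc]; exact mul_le_mul_of_nonneg_right (le_abs_self _) hαℓ
  have hC₂ : C₂ * Skeleton.alpha D * Skeleton.ell D ≤ |C₂| * (Skeleton.alpha D * Skeleton.ell D) := by
    rw [mul_assoc]; exact mul_le_mul_of_nonneg_right (le_abs_self _) hαℓ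
  have hC₃ : C₃ * Skeleton.alpha D * Skeleton.ell D ≤ |C₃| * (Skeleton.alpha D * Skeleton.ell D) := by
    rw [mul_assoc]; exact mul_le_mul_of_nonneg_right (le_abs_self _) hαℓ
  nlinarith [key, e₁, e₂, e₃, hC₁, hC₂, hC₃]

end Literature.NumberTheory.LFunctions.Zhang2022.Numerics

namespace Literature.NumberTheory.LFunctions.Zhang2022.Numerics

open Literature.NumberTheory.LFunctions.Zhang2022

/-! ## Row N-18: the main-value algebra behind the weights `(1, 2, 1)` of (15.24) and the sign of (16.17)

§15 p.88 (tex L4376–4392): "By Lemma 5.8, `ℛ₁* = β₁β₂L′(1,χ) + O(1/𝓛²⁴)` and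
`ℛ₁ⱼ = P₄^{β₃−βⱼ}/((β_{j+1} − βⱼ)(β_{j+2} − βⱼ)L′(1,χ)) + O(1/𝓛³)`. Hence, by direct calculation,
`ℛ₁*ℛ₁₁ = 1 + O(1/𝓛)`, `ℛ₁*ℛ₁₂ = 2 + O(1/𝓛)`, `ℛ₁*ℛ₁₃ = 1 + O(1/𝓛)`" (indices mod 3: `β₄ = β₁`,
`β₅ = β₂`, §8 tex L2331); §16 p.94 (tex L4674–4681): "`ℛ₂* = β₁ + O(1/𝓛¹⁰)`, `ℛ₂ⱼ = −1/(β₁L′(1,χ)) + O(𝓛⁶)`,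
so that `ℛ₂*ℛ₂ⱼ = −1/L′(1,χ) + O(𝓛⁻¹L′(1,χ)⁻¹)`" and "Since `(pt₀)^{β₁} = −1 + O(α₁)`". The "direct
calculation" is algebra at the MAIN VALUES `β_k = kiα` ((2.13) with the `c′`-corrections dropped) and
`P₄^{iα} = −1` (`P₄ = PT⁻²t₀`, tex L1689; `P^{iα} = e^{iα𝓛⁹} = e^{iπ} = −1` by (2.6), (2.10)). The typed
asymptotic nodes are `Typed.Section15C.Step15_u058`–`Step15_u062` (L4-t3); here only the exact identities
at the main values are recorded (NUMERICS row N-18, symbolic, no kit job; checked by hand by num-1 and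
in the kernel below), plus the EXACT `D`-dependence of the phase `P₄^{iα}` (`P4_cpow_I_alpha`).
-/

/-- **N-18 (a)** [Z22 p.88, tex L4385–4392]: at the main values `β_k = kiα` (`α ≠ 0`), `L = L′(1,χ) ≠ 0`,
`P₄^{iα} = −1` (so `P₄^{β₃−β₁} = (−1)²`, `P₄^{β₃−β₂} = (−1)¹`, `P₄^{β₃−β₃} = 1`), the products
`ℛ₁*·ℛ₁ⱼ = (β₁β₂L)·P₄^{β₃−βⱼ}/((β_{j+1}−βⱼ)(β_{j+2}−βⱼ)L)` are EXACTLY `1, 2, 1` for `j = 1, 2, 3`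
(`β₄ = β₁`, `β₅ = β₂`). [cite: Zhang2022LandauSiegel, §15 p.88] -/
def n18_r1_products_num : Prop :=
  ∀ (α : ℝ) (L : ℂ), α ≠ 0 → L ≠ 0 →
    (I * α * (2 * I * α) * L) * ((-1 : ℂ) ^ 2 / ((2 * I * α - I * α) * (3 * I * α - I * α) * L)) = 1 ∧
    (I * α * (2 * I * α) * L) * ((-1 : ℂ) ^ 1 / ((3 * I * α - 2 * I * α) * (I * α - 2 * I * α) * L)) = 2 ∧
    (I * α * (2 * I * α) * L) * ((-1 : ℂ) ^ 0 / ((I * α - 3 * I * α) * (2 * I * α - 3 * I * α) * L)) = 1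

/-- N-18 (a) holds (`field_simp`/`ring` over `ℂ`). [cite: Zhang2022LandauSiegel, §15 p.88] -/
theorem n18_r1_products_num_holds : n18_r1_products_num := by
  intro α L hα hL
  have hαC : (α : ℂ) ≠ 0 := by exact_mod_cast hα
  have hI : (I : ℂ) ≠ 0 := Complex.I_ne_zero
  refine ⟨?_, ?_, ?_⟩
  · field_simp
    ring_nf
  · field_simp
    ring_nf
  · field_simp
    ring_nf

/-- **N-18 (b)** [Z22 p.94, tex L4674–4678]: at the main values `ℛ₂* = β₁`, `ℛ₂ⱼ = −1/(β₁L′(1,χ))`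
(`β₁ ≠ 0`, `L′(1,χ) ≠ 0`), `ℛ₂*ℛ₂ⱼ = −1/L′(1,χ)` exactly. [cite: Zhang2022LandauSiegel, §16 p.94] -/
def n18_r2_product_num : Prop :=
  ∀ (β L : ℂ), β ≠ 0 → L ≠ 0 → β * (-(1 / (β * L))) = -(1 / L)

/-- N-18 (b) holds. [cite: Zhang2022LandauSiegel, §16 p.94] -/
theorem n18_r2_product_num_holds : n18_r2_product_num := by
  intro β L hβ hL
  field_simp

/-- **N-18 (c)**, the phase convention: `e^{kπi} = (−1)^k` — the main value of `P₄^{β_k} = P₄^{kiα}`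
and of `(pt₀)^{β_k}` for `p ∼ P` (`P^{iα} = e^{iπ}`). [cite: Zhang2022LandauSiegel, §16 p.95, §15 p.88] -/
def n18_phase_num : Prop := ∀ k : ℕ, cexp (k * (π * I)) = (-1 : ℂ) ^ k

/-- N-18 (c) holds (`exp_nat_mul`, `exp_pi_mul_I`). [cite: Zhang2022LandauSiegel, §16 p.95] -/
theorem n18_phase_num_holds : n18_phase_num := by
  intro k
  rw [Complex.exp_nat_mul, Complex.exp_pi_mul_I]

/-- The main values ARE the Skeleton's shifts at `c′ = 0`: `β₁ = iα`, `β₂ = 2iα`, `β₃ = 3iα`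
(`Skeleton.beta1/2/3`, (2.13)), and `β₆ = 3iα/2`, `β₇ = 5iα/2` ((2.22)) for every `c′`.
[cite: Zhang2022LandauSiegel, (2.13), (2.22)] -/
theorem beta_main_values (D : ℕ) :
    Skeleton.beta1 0 D = I * Skeleton.alpha D ∧ Skeleton.beta2 0 D = 2 * I * Skeleton.alpha D ∧
      Skeleton.beta3 0 D = 3 * I * Skeleton.alpha D := by
  refine ⟨?_, ?_, ?_⟩ <;> simp [Skeleton.beta1, Skeleton.beta2, Skeleton.beta3]

/-- **The exact phase of `P₄`**: for `D ≥ 3`,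
`P₄^{iα} = −exp(−iα(2𝓛^{1.1} − 519 log 𝓛))` (`P₄ = PT⁻²t₀`, `log P₄ = 𝓛⁹ − 2𝓛^{1.1} + 519 log 𝓛`,
`α𝓛⁹ = π`); since `α(2𝓛^{1.1} − 519 log 𝓛) = O(𝓛^{−7.9})`, the main value is `−1` as the manuscript uses.
[cite: Zhang2022LandauSiegel, §6 (P₄, tex L1689), (2.6), (2.10)] -/
theorem P4_cpow_I_alpha {D : ℕ} (hD : 3 ≤ D) :
    ((Skeleton.P4 D : ℝ) : ℂ) ^ (I * Skeleton.alpha D)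
      = -cexp (-(I * Skeleton.alpha D *
          (2 * (Skeleton.ell D : ℂ) ^ ((1.1 : ℝ) : ℂ) - 519 * Real.log (Skeleton.ell D)))) := by
  have h1 : 1 < Skeleton.ell D := Skeleton.one_lt_ell hD
  have hℓ : 0 < Skeleton.ell D := by linarith
  have hP : 0 < Skeleton.bigP D := Real.exp_pos _
  have hT : 0 < Skeleton.bigT D := Real.exp_pos _
  have ht0 : 0 < Skeleton.t0 D := by rw [Skeleton.t0]; positivity
  have hP4 : 0 < Skeleton.P4 D := by rw [Skeleton.P4]; positivity
  have hP40 : ((Skeleton.P4 D : ℝ) : ℂ) ≠ 0 := by exact_mod_cast hP4.ne'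
  -- log P₄ = 𝓛⁹ − 2𝓛^{1.1} + 519 log 𝓛
  have hlog : Real.log (Skeleton.P4 D)
      = Skeleton.ell D ^ 9 - 2 * Skeleton.ell D ^ (1.1 : ℝ) + 519 * Real.log (Skeleton.ell D) := by
    rw [Skeleton.P4, Real.log_mul (by positivity) ht0.ne', Real.log_div hP.ne' (by positivity),
      Skeleton.log_bigP, Real.log_pow, Skeleton.bigT, Real.log_exp, Skeleton.t0, Real.log_pow]
    push_cast; ring
  rw [Complex.cpow_def_of_ne_zero hP40, ← Complex.ofReal_log hP4.le, hlog]
  have hπ : cexp (↑π * I) = -1 := Complex.exp_pi_mul_I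
  have hα9 : (Skeleton.ell D ^ 9 : ℂ) * (Skeleton.alpha D : ℂ) = (π : ℂ) := by
    have h := alpha_mul_ell9 hD
    rw [mul_comm]; exact_mod_cast h
  rw [show -cexp (-(I * Skeleton.alpha D * (2 * (Skeleton.ell D : ℂ) ^ ((1.1 : ℝ) : ℂ)
      - 519 * Real.log (Skeleton.ell D)))) = cexp (↑π * I) * cexp (-(I * Skeleton.alpha D *
      (2 * (Skeleton.ell D : ℂ) ^ ((1.1 : ℝ) : ℂ) - 519 * Real.log (Skeleton.ell D)))) by rw [hπ]; ring,
    ← Complex.exp_add]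
  congr 1
  have hrpow : ((Skeleton.ell D ^ (1.1 : ℝ) : ℝ) : ℂ) = (Skeleton.ell D : ℂ) ^ ((1.1 : ℝ) : ℂ) :=
    Complex.ofReal_cpow hℓ.le _
  push_cast
  rw [hrpow]
  linear_combination (I : ℂ) * hα9

end Literature.NumberTheory.LFunctions.Zhang2022.Numerics
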